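import Literature.AlgebraicGeometry.Motives.ProperIntegralPoints
import Literature.NumberTheory.GaloisRepresentations.ClosureValuationSubring
import Literature.NumberTheory.GaloisRepresentations.DecompositionGroupOfCompletion
import Literature.NumberTheory.DiophantineGeometry.AbelianSchemeModelSpecialFibre
import Literature.NumberTheory.DiophantineGeometry.AbelianVarietyOrdinaryReductionFiltrationProofs
import HarnessLib

/-!
# The reduction map of an abelian-scheme model at a finite place

Let `A` be an abelian variety over a number field `K`, `v` a finite place, `𝒜 → Spec 𝓞_{K,v}` an
abelian-scheme model of `A` at `v` (`IsAbelianSchemeModel A v 𝒜`), `F = K_v`,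
`Ω = F̄ = AlgebraicClosure K_v`, `R = {x ∈ Ω : ‖x‖ ≤ 1}` the valuation ring of `Ω`
(`closureValuationSubring F`) with residue field `κ(R)` (an algebraic closure of `κ(v)`).
This file constructs the **reduction map**

  `A(Ω) = Hom_{𝓞_{K,v}}(Spec Ω, 𝒜) ≃ Hom_{𝓞_{K,v}}(Spec R, 𝒜) → Hom_{𝓞_{K,v}}(Spec κ(R), 𝒜) = 𝒜_v(κ(R))`

(valuative criterion of properness, `ProperIntegralPoints`), a group homomorphism
(`reductionHom`), the action of `Γ_{K_v}` on `𝒜_v(κ(R))` through its action on `κ(R)`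
(`instMulDistribMulActionSpecialFibrePoints`), and proves that the reduction map is
**`Γ_{K_v}`-equivariant** (`reductionHom_smul`) and that **the inertia group acts trivially on
`𝒜_v(κ(R))`** (`smul_specialFibrePoint_of_mem_absInertia`) — Serre–Tate, *Good reduction of
abelian varieties*, §1, Lemma 2 and the proof of Thm. 1 (reduction map `A(K̄) → Ã(k̄)`,
`I(v̄)` acts trivially on `Ã`).

## References
* [SerreTate1968GoodReduction] J.-P. Serre, J. Tate, *Good reduction of abelian varieties*,
  Ann. of Math. 88 (1968), §1 (reduction map; Lemma 2).
* [Hartshorne1977] R. Hartshorne, *Algebraic Geometry*, II.4.7 (valuative criterion).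
-/

noncomputable section

open CategoryTheory AlgebraicGeometry IsDedekindDomain IsDedekindDomain.HeightOneSpectrum
open ValuativeRel Field IsLocalRing
open scoped MonObj NumberField CategoryTheory.Obj
open Literature.AlgebraicGeometry.Motives (AbelianVariety SchemeOver residueAt residueAt_surjective
  residueFieldEquiv specOver
  specValuationSubring specRingHomOver specRingHomι specFractionField specFractionFieldι
  restrictPoint extendPoint reducePointMonoidHom specValuationSubringMap specRingHomOverMap)
open Literature.NumberTheory.GaloisRepresentations
open Literature.NumberTheory.EllipticCurves

namespace Literature.NumberTheory.DiophantineGeometry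

variable {K : Type} [Field K] [NumberField K] (v : HeightOneSpectrum (𝓞 K))

/-! ## `𝓞_{K,v} → 𝒪_{K_v} → R` -/

/-- Elements of the local ring `𝓞_{K,v} ⊆ K` are `v`-adic integers of `K_v`. [folklore] -/
theorem algebraMap_mem_integer_adicCompletion (x : valuationSubringAtPrime K v) :
    algebraMap K (v.adicCompletion K) (x : K) ∈ 𝒪[v.adicCompletion K] := by
  rw [Valuation.mem_integer_iff, adicCompletion_valuation_le_one_iff K v,
    ← mem_adicCompletionIntegers_iff_norm_le_one, mem_adicCompletionIntegers]
  change Valued.v ((x : K) : v.adicCompletion K) ≤ 1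
  rw [valuedAdicCompletion_eq_valuation']
  have hx : (x : K) ∈ (v.valuation K).valuationSubring := by
    rw [← valuationSubringAtPrime_eq_valuationSubring]; exact x.2
  exact hx

/-- The structure map `𝓞_{K,v} → 𝒪_{K_v}` (through `K → K_v`). [folklore] -/
def toLocalInteger : valuationSubringAtPrime K v →+* 𝒪[v.adicCompletion K] where
  toFun x := ⟨algebraMap K (v.adicCompletion K) (x : K), algebraMap_mem_integer_adicCompletion v x⟩
  map_one' := Subtype.ext (by simp)
  map_mul' x y := Subtype.ext (by simp)
  map_zero' := Subtype.ext (by simp)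
  map_add' x y := Subtype.ext (by simp)

/-- Underlying element of `toLocalInteger`. [folklore] -/
@[simp] theorem coe_toLocalInteger (x : valuationSubringAtPrime K v) :
    ((toLocalInteger v x : 𝒪[v.adicCompletion K]) : v.adicCompletion K) =
      algebraMap K (v.adicCompletion K) (x : K) :=
  rfl

/-- The structure map `𝓞_{K,v} → R = {‖x‖ ≤ 1} ⊆ K̄_v`. [folklore] -/
def toClosureValuationSubring :
    valuationSubringAtPrime K v →+* closureValuationSubring (v.adicCompletion K) :=
  (integerToClosureValuationSubring (v.adicCompletion K)).comp (toLocalInteger v)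

/-- `𝓞_{K,v} → R ⊆ Ω` is the structure map `𝓞_{K,v} → K → Ω`. [folklore] -/
theorem algebraMap_comp_toClosureValuationSubring :
    (algebraMap (closureValuationSubring (v.adicCompletion K))
        (AlgebraicClosure (v.adicCompletion K))).comp (toClosureValuationSubring v) =
      (algebraMap K (AlgebraicClosure (v.adicCompletion K))).comp
        (algebraMap (valuationSubringAtPrime K v) K) := by
  ext x
  change (((integerToClosureValuationSubring (v.adicCompletion K)) (toLocalInteger v x) :
      closureValuationSubring (v.adicCompletion K)) : AlgebraicClosure (v.adicCompletion K)) =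
    algebraMap K (AlgebraicClosure (v.adicCompletion K)) (x : K)
  rw [coe_integerToClosureValuationSubring,
    IsScalarTower.algebraMap_apply 𝒪[v.adicCompletion K] (v.adicCompletion K)
      (AlgebraicClosure (v.adicCompletion K)),
    IsScalarTower.algebraMap_apply K (v.adicCompletion K) (AlgebraicClosure (v.adicCompletion K))]
  rfl

/-- `Γ_{K_v}` fixes `𝓞_{K,v} ⊆ R`. [folklore] -/
theorem closureValuationSubringMap_comp_toClosureValuationSubring
    (σ : absoluteGaloisGroup (v.adicCompletion K)) :
    (closureValuationSubringMap σ).comp (toClosureValuationSubring v) = toClosureValuationSubring v := by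
  rw [toClosureValuationSubring, ← RingHom.comp_assoc,
    closureValuationSubringMap_comp_integerToClosureValuationSubring]

/-! ## `Spec Ω`, `Spec R`, `Spec κ(R)` over `𝓞_{K,v}` and the points of `𝒜` -/

/-- `Spec Ω → Spec 𝓞_{K,v}` through `R` is `Over.map (Spec K → Spec 𝓞_{K,v})` of the `K`-scheme
`Spec Ω` (both are `Spec` of `𝓞_{K,v} → Ω`). [folklore] -/
def specFractionFieldIso :
    specFractionField (closureValuationSubring (v.adicCompletion K)) (toClosureValuationSubring v) ≅
      (Over.map (specGenericPoint (valuationSubringAtPrime K v) K)).obj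
        (specOver K (AlgebraicClosure (v.adicCompletion K))) :=
  Over.isoMk (Iso.refl _) (by
    change 𝟙 _ ≫ Spec.map _ ≫ Spec.map _ = Spec.map _ ≫ Spec.map _
    rw [Category.id_comp, ← Spec.map_comp, ← Spec.map_comp, ← CommRingCat.ofHom_comp,
      ← CommRingCat.ofHom_comp, algebraMap_comp_toClosureValuationSubring])

section Model

variable {v} {A : AbelianVariety K} {𝒜 : SchemeOver (valuationSubringAtPrime K v)} [GrpObj 𝒜]

/-- The adjunction bijection `Hom_{𝓞_{K,v}}(U, 𝒳) ≃ Hom_K(U, 𝒳_K)` (for a `K`-scheme `U` viewed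
over `𝓞_{K,v}`) is multiplicative for a group scheme `𝒳` (generic fibre functor monoidal,
`MonObj.comp_mul`). [folklore] -/
theorem homEquiv_mapPullbackAdj_generic_mul (𝒳 : SchemeOver (valuationSubringAtPrime K v)) [GrpObj 𝒳]
    (U : SchemeOver K) (f g : (Over.map (specGenericPoint (valuationSubringAtPrime K v) K)).obj U ⟶ 𝒳) :
    (Over.mapPullbackAdj (specGenericPoint (valuationSubringAtPrime K v) K)).homEquiv U 𝒳 (f * g) =
      (Over.mapPullbackAdj (specGenericPoint (valuationSubringAtPrime K v) K)).homEquiv U 𝒳 f *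
        (Over.mapPullbackAdj (specGenericPoint (valuationSubringAtPrime K v) K)).homEquiv U 𝒳 g := by
  rw [Adjunction.homEquiv_unit, Adjunction.homEquiv_unit, Adjunction.homEquiv_unit,
    Functor.map_mul]
  exact MonObj.comp_mul _ _ _

/-- **`Hom_{𝓞_{K,v}}(Spec Ω, 𝒜) ≃* A(Ω)`**: an `Ω`-point of the model over `𝓞_{K,v}` is an
`Ω`-point of the generic fibre `𝒜_K ≅ A` (adjunction `Over.map ⊣ Over.pullback` and the chosen
group isomorphism `𝒜_K ≅ A.X` of the model). [folklore] -/
def IsAbelianSchemeModel.fractionFieldPointsEquiv (h : IsAbelianSchemeModel A v 𝒜) :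
    (specFractionField (closureValuationSubring (v.adicCompletion K)) (toClosureValuationSubring v) ⟶ 𝒜) ≃*
      A.Points (AlgebraicClosure (v.adicCompletion K)) :=
  haveI := h.exists_iso.choose_spec
  (MulEquiv.mk'
    (((specFractionFieldIso v).homCongr (Iso.refl 𝒜)).trans
      ((Over.mapPullbackAdj (specGenericPoint (valuationSubringAtPrime K v) K)).homEquiv _ 𝒜))
    (fun P Q ↦ by
      change (Over.mapPullbackAdj _).homEquiv _ 𝒜 ((specFractionFieldIso v).inv ≫ (P * Q) ≫ (Iso.refl 𝒜).hom) =
        (Over.mapPullbackAdj _).homEquiv _ 𝒜 ((specFractionFieldIso v).inv ≫ P ≫ (Iso.refl 𝒜).hom) *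
          (Over.mapPullbackAdj _).homEquiv _ 𝒜 ((specFractionFieldIso v).inv ≫ Q ≫ (Iso.refl 𝒜).hom)
      rw [Iso.refl_hom, Category.comp_id, Category.comp_id, Category.comp_id, MonObj.comp_mul]
      exact homEquiv_mapPullbackAdj_generic_mul 𝒜 _ _ _)).trans
    ((IsMonHom.monoidHom h.exists_iso.choose.hom (specOver K (AlgebraicClosure (v.adicCompletion K)))).toMulEquiv
        (IsMonHom.monoidHom h.exists_iso.choose.inv (specOver K (AlgebraicClosure (v.adicCompletion K))))
        (by ext P; simp) (by ext P; simp))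

/-- Unfolding `fractionFieldPointsEquiv`: adjoint of `e⁻¹ ≫ P`, followed by `𝒜_K ≅ A.X`.
[folklore] -/
theorem IsAbelianSchemeModel.fractionFieldPointsEquiv_apply (h : IsAbelianSchemeModel A v 𝒜)
    (P : specFractionField (closureValuationSubring (v.adicCompletion K)) (toClosureValuationSubring v) ⟶ 𝒜) :
    h.fractionFieldPointsEquiv P =
      (Over.mapPullbackAdj (specGenericPoint (valuationSubringAtPrime K v) K)).homEquiv _ 𝒜
          ((specFractionFieldIso v).inv ≫ P) ≫ h.exists_iso.choose.hom := by
  change (Over.mapPullbackAdj (specGenericPoint (valuationSubringAtPrime K v) K)).homEquiv _ 𝒜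
      ((specFractionFieldIso v).inv ≫ P ≫ (Iso.refl 𝒜).hom) ≫ h.exists_iso.choose.hom = _
  rw [Iso.refl_hom, Category.comp_id]

end Model

/-! ## The action of `Γ_{K_v}` on `Spec Ω`, `Spec R`, `Spec κ(R)` over `𝓞_{K,v}` and on points -/

section GaloisAction

/-- The `𝓞_{K,v}`-automorphism of `Spec Ω` induced by `σ ∈ Γ_{K_v}` (`Spec σ`). [folklore] -/
abbrev specFractionFieldMap (σ : absoluteGaloisGroup (v.adicCompletion K)) :
    specFractionField (closureValuationSubring (v.adicCompletion K)) (toClosureValuationSubring v) ⟶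
      specFractionField (closureValuationSubring (v.adicCompletion K)) (toClosureValuationSubring v) :=
  specRingHomOverMap (algebraMap _ _) (closureValuationSubringMap σ)
    (closureValuationSubringMap_comp_toClosureValuationSubring v σ)
    (absoluteGaloisGroup.toAlgEquiv (v.adicCompletion K) σ).toAlgHom.toRingHom
    (algebraMap_comp_closureValuationSubringMap σ)

/-- The `𝓞_{K,v}`-automorphism of `Spec κ(R)` induced by `σ ∈ Γ_{K_v}` (`Spec σ̄`). [folklore] -/
abbrev specResidueFieldMap (σ : absoluteGaloisGroup (v.adicCompletion K)) :
    specRingHomOver (closureValuationSubring (v.adicCompletion K)) (toClosureValuationSubring v)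
        (IsLocalRing.residue (closureValuationSubring (v.adicCompletion K))) ⟶
      specRingHomOver (closureValuationSubring (v.adicCompletion K)) (toClosureValuationSubring v)
        (IsLocalRing.residue (closureValuationSubring (v.adicCompletion K))) :=
  specRingHomOverMap (IsLocalRing.residue _) (closureValuationSubringMap σ)
    (closureValuationSubringMap_comp_toClosureValuationSubring v σ)
    (residueFieldMap σ) (residueFieldMap_comp_residue σ)

/-- `Spec 1̄ = 𝟙`. [folklore] -/
theorem specResidueFieldMap_one : specResidueFieldMap v 1 = 𝟙 _ := by
  ext : 1
  change Spec.map (CommRingCat.ofHom (residueFieldMap 1)) = 𝟙 _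
  rw [residueFieldMap_one]
  exact Spec.map_id _

/-- `Spec (στ)̄ = Spec σ̄ ≫ Spec τ̄` (two contravariances cancel). [folklore] -/
theorem specResidueFieldMap_mul (σ τ : absoluteGaloisGroup (v.adicCompletion K)) :
    specResidueFieldMap v (σ * τ) = specResidueFieldMap v σ ≫ specResidueFieldMap v τ := by
  ext : 1
  change Spec.map (CommRingCat.ofHom (residueFieldMap (σ * τ))) =
    Spec.map (CommRingCat.ofHom (residueFieldMap σ)) ≫ Spec.map (CommRingCat.ofHom (residueFieldMap τ))
  rw [residueFieldMap_mul, CommRingCat.ofHom_comp, Spec.map_comp]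

/-- **Inertia acts trivially on `Spec κ(R)`**: for `σ ∈ I_{K_v}`, `Spec σ̄ = 𝟙`.
[cite: SerreTate1968GoodReduction, §1 Lemma 2] -/
theorem specResidueFieldMap_eq_id_of_mem_absInertia {σ : absoluteGaloisGroup (v.adicCompletion K)}
    (hσ : σ ∈ absInertia (v.adicCompletion K)) : specResidueFieldMap v σ = 𝟙 _ := by
  ext : 1
  change Spec.map (CommRingCat.ofHom (residueFieldMap σ)) = 𝟙 _
  rw [residueFieldMap_eq_id_of_mem_absInertia hσ]
  exact Spec.map_id _

variable {v}

/-- `𝒳(κ(R))`: the points of an `𝓞_{K,v}`-scheme `𝒳` with values in the residue field `κ(R)` of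
`R ⊆ K̄_v` (an algebraic closure of `κ(v)`), i.e. geometric points of the special fibre. [folklore] -/
abbrev residueFieldPoints (𝒳 : SchemeOver (valuationSubringAtPrime K v)) : Type :=
  specRingHomOver (closureValuationSubring (v.adicCompletion K)) (toClosureValuationSubring v)
      (IsLocalRing.residue (closureValuationSubring (v.adicCompletion K))) ⟶ 𝒳

/-- `Γ_{K_v}` acts on `𝒳(κ(R))` through its action on `κ(R)`: `σ • P = Spec σ̄ ≫ P` (LEFT action,
same convention as `AlgPoints.instMulActionAlgEquiv`). [cite: SerreTate1968GoodReduction, §1] -/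
instance residueFieldPoints.instMulAction (𝒳 : SchemeOver (valuationSubringAtPrime K v)) :
    MulAction (absoluteGaloisGroup (v.adicCompletion K)) (residueFieldPoints 𝒳) where
  smul σ P := specResidueFieldMap v σ ≫ P
  one_smul P := by
    change specResidueFieldMap v 1 ≫ P = P
    rw [specResidueFieldMap_one, Category.id_comp]
  mul_smul σ τ P := by
    change specResidueFieldMap v (σ * τ) ≫ P = specResidueFieldMap v σ ≫ specResidueFieldMap v τ ≫ P
    rw [specResidueFieldMap_mul, Category.assoc]

/-- Definition of the action on `𝒳(κ(R))`. [folklore] -/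
theorem residueFieldPoints.smul_def {𝒳 : SchemeOver (valuationSubringAtPrime K v)}
    (σ : absoluteGaloisGroup (v.adicCompletion K)) (P : residueFieldPoints 𝒳) :
    σ • P = specResidueFieldMap v σ ≫ P := rfl

/-- For a group scheme `𝒳`, `Γ_{K_v}` acts on the group `𝒳(κ(R))` by automorphisms
(precomposition is a homomorphism, `MonObj.comp_mul`). [folklore] -/
instance residueFieldPoints.instMulDistribMulAction (𝒳 : SchemeOver (valuationSubringAtPrime K v))
    [GrpObj 𝒳] : MulDistribMulAction (absoluteGaloisGroup (v.adicCompletion K)) (residueFieldPoints 𝒳) where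
  smul_mul _ _ _ := MonObj.comp_mul _ _ _
  smul_one _ := MonObj.comp_one _

/-- **The inertia group acts trivially on the points of the special fibre.** For `σ ∈ I_{K_v}`
and `P ∈ 𝒳(κ(R))`, `σ • P = P`. [cite: SerreTate1968GoodReduction, §1 Lemma 2] -/
theorem residueFieldPoints.smul_eq_self_of_mem_absInertia {𝒳 : SchemeOver (valuationSubringAtPrime K v)}
    {σ : absoluteGaloisGroup (v.adicCompletion K)} (hσ : σ ∈ absInertia (v.adicCompletion K))
    (P : residueFieldPoints 𝒳) : σ • P = P := by
  rw [residueFieldPoints.smul_def, specResidueFieldMap_eq_id_of_mem_absInertia v hσ, Category.id_comp]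

/-- `Γ_{K_v}` acts on the `K̄_v`-points `X(K̄_v)` of a `K`-scheme through
`Γ_{K_v} → Aut(K̄_v / K)` (restriction of scalars) and the action of the latter
(`AlgPoints.instMulActionAlgEquiv`). [folklore] -/
instance AlgPoints.instMulActionAbsoluteGaloisGroupAdicCompletion (X : SchemeOver K) :
    MulAction (absoluteGaloisGroup (v.adicCompletion K))
      (Literature.AlgebraicGeometry.Motives.AlgPoints X (AlgebraicClosure (v.adicCompletion K))) :=
  MulAction.compHom _ ((AlgEquiv.restrictScalarsHom K).comp
    (absoluteGaloisGroup.toAlgEquiv (v.adicCompletion K)).toMonoidHom)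

/-- Definition of the action on `X(K̄_v)`. [folklore] -/
theorem AlgPoints.adicCompletion_smul_def {X : SchemeOver K} (σ : absoluteGaloisGroup (v.adicCompletion K))
    (P : Literature.AlgebraicGeometry.Motives.AlgPoints X (AlgebraicClosure (v.adicCompletion K))) :
    σ • P = AlgEquiv.restrictScalars K (absoluteGaloisGroup.toAlgEquiv (v.adicCompletion K) σ) • P :=
  rfl

/-- `Γ_{K_v}` acts on `A(K̄_v)` by group automorphisms. [folklore] -/
instance Points.instMulDistribMulActionAbsoluteGaloisGroupAdicCompletion (A : AbelianVariety K) :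
    MulDistribMulAction (absoluteGaloisGroup (v.adicCompletion K))
      (A.Points (AlgebraicClosure (v.adicCompletion K))) where
  smul_mul σ P Q := smul_mul' (AlgEquiv.restrictScalars K
    (absoluteGaloisGroup.toAlgEquiv (v.adicCompletion K) σ)) P Q
  smul_one σ := smul_one (AlgEquiv.restrictScalars K
    (absoluteGaloisGroup.toAlgEquiv (v.adicCompletion K) σ))

/-- Compatibility of `specFractionFieldIso` with the two descriptions of `Spec σ`. [folklore] -/
theorem specFractionFieldIso_inv_comp_specFractionFieldMap (σ : absoluteGaloisGroup (v.adicCompletion K)) :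
    (specFractionFieldIso v).inv ≫ specFractionFieldMap v σ =
      (Over.map (specGenericPoint (valuationSubringAtPrime K v) K)).map
          (Literature.AlgebraicGeometry.Motives.AlgPoints.specMap
            (AlgEquiv.restrictScalars K (absoluteGaloisGroup.toAlgEquiv (v.adicCompletion K) σ))) ≫
        (specFractionFieldIso v).inv := by
  ext : 1
  change 𝟙 _ ≫ Spec.map _ = Spec.map _ ≫ 𝟙 _
  rw [Category.id_comp, Category.comp_id]
  rfl

variable {A : AbelianVariety K} {𝒜 : SchemeOver (valuationSubringAtPrime K v)} [GrpObj 𝒜]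

/-- **`Hom_{𝓞_{K,v}}(Spec Ω, 𝒜) ≃ A(Ω)` is `Γ_{K_v}`-equivariant.** [folklore] -/
theorem IsAbelianSchemeModel.fractionFieldPointsEquiv_specFractionFieldMap_comp
    (h : IsAbelianSchemeModel A v 𝒜) (σ : absoluteGaloisGroup (v.adicCompletion K))
    (P : specFractionField (closureValuationSubring (v.adicCompletion K)) (toClosureValuationSubring v) ⟶ 𝒜) :
    h.fractionFieldPointsEquiv (specFractionFieldMap v σ ≫ P) = σ • h.fractionFieldPointsEquiv P := by
  rw [h.fractionFieldPointsEquiv_apply, h.fractionFieldPointsEquiv_apply, ← Category.assoc,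
    specFractionFieldIso_inv_comp_specFractionFieldMap, Category.assoc,
    Adjunction.homEquiv_naturality_left, Category.assoc]
  rfl

/-- Equivariance of the inverse identification. [folklore] -/
theorem IsAbelianSchemeModel.fractionFieldPointsEquiv_symm_smul
    (h : IsAbelianSchemeModel A v 𝒜) (σ : absoluteGaloisGroup (v.adicCompletion K))
    (P : A.Points (AlgebraicClosure (v.adicCompletion K))) :
    h.fractionFieldPointsEquiv.symm (σ • P) =
      specFractionFieldMap v σ ≫ h.fractionFieldPointsEquiv.symm P := by
  apply h.fractionFieldPointsEquiv.injective
  rw [MulEquiv.apply_symm_apply, h.fractionFieldPointsEquiv_specFractionFieldMap_comp,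
    MulEquiv.apply_symm_apply]

/-! ## The reduction map -/

/-- **The reduction map `A(K̄_v) → 𝒜_v(κ(R))`** of an abelian-scheme model: an `Ω`-point of
`A = 𝒜_K` is an `Ω`-point of `𝒜`, extends uniquely to an `R`-point (`𝒜` proper, valuative
criterion), and is specialised to the residue field `κ(R)`; a group homomorphism.
Serre–Tate §1 ("the reduction map `A(K̄) → Ã(k̄)`"). [cite: SerreTate1968GoodReduction, §1] -/
def IsAbelianSchemeModel.reductionHom (h : IsAbelianSchemeModel A v 𝒜) :
    A.Points (AlgebraicClosure (v.adicCompletion K)) →* residueFieldPoints 𝒜 :=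
  haveI := h.isProper
  (reducePointMonoidHom (closureValuationSubring (v.adicCompletion K)) (toClosureValuationSubring v) 𝒜
      (IsLocalRing.residue _)).comp h.fractionFieldPointsEquiv.symm.toMonoidHom

/-- Unfolding the reduction map. [folklore] -/
theorem IsAbelianSchemeModel.reductionHom_apply (h : IsAbelianSchemeModel A v 𝒜)
    (P : A.Points (AlgebraicClosure (v.adicCompletion K))) :
    h.reductionHom P = (haveI := h.isProper;
      reducePointMonoidHom (closureValuationSubring (v.adicCompletion K)) (toClosureValuationSubring v) 𝒜
        (IsLocalRing.residue _) (h.fractionFieldPointsEquiv.symm P)) :=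
  rfl

/-- **The reduction map is `Γ_{K_v}`-equivariant**: `red (σ • P) = σ • red P`, where `Γ_{K_v}`
acts on `𝒜_v(κ(R))` through `Γ_{K_v} → Aut(κ(R)/κ(v))` (uniqueness in the valuative criterion).
Serre–Tate §1. [cite: SerreTate1968GoodReduction, §1] -/
theorem IsAbelianSchemeModel.reductionHom_smul (h : IsAbelianSchemeModel A v 𝒜)
    (σ : absoluteGaloisGroup (v.adicCompletion K)) (P : A.Points (AlgebraicClosure (v.adicCompletion K))) :
    h.reductionHom (σ • P) = σ • h.reductionHom P := by
  haveI := h.isProper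
  rw [h.reductionHom_apply, h.reductionHom_apply, h.fractionFieldPointsEquiv_symm_smul,
    residueFieldPoints.smul_def]
  exact Literature.AlgebraicGeometry.Motives.reducePointMonoidHom_naturality _ _ 𝒜 _ _ _ _ _ _ _ _

/-- **Inertia acts trivially on reductions**: for `σ ∈ I_{K_v}`, `red (σ • P) = red P`.
[cite: SerreTate1968GoodReduction, §1 Lemma 2] -/
theorem IsAbelianSchemeModel.reductionHom_smul_of_mem_absInertia (h : IsAbelianSchemeModel A v 𝒜)
    {σ : absoluteGaloisGroup (v.adicCompletion K)} (hσ : σ ∈ absInertia (v.adicCompletion K))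
    (P : A.Points (AlgebraicClosure (v.adicCompletion K))) :
    h.reductionHom (σ • P) = h.reductionHom P := by
  rw [h.reductionHom_smul, residueFieldPoints.smul_eq_self_of_mem_absInertia hσ]

end GaloisAction

/-! ## The residue field `κ(R)` as an algebraic closure of `κ(v)`; comparison with the geometric
special fibre -/

section ResidueField

/-- Units of `𝒪_{K_v}` coming from `𝓞_{K,v}` are units of `𝓞_{K,v}`: the structure map
`𝓞_{K,v} → 𝒪_{K_v}` is a local homomorphism. [folklore] -/
instance isLocalHom_toLocalInteger : IsLocalHom (toLocalInteger v) := by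
  refine ⟨fun x hx ↦ ?_⟩
  -- `‖x‖_v = 1`
  have h1 : Valued.v ((x : K) : v.adicCompletion K) = 1 := by
    obtain ⟨u, hu⟩ := hx
    have hle : ∀ y : 𝒪[v.adicCompletion K], Valued.v (y : v.adicCompletion K) ≤ 1 := fun y ↦ by
      have := y.2
      rw [Valuation.mem_integer_iff, adicCompletion_valuation_le_one_iff K v,
        ← mem_adicCompletionIntegers_iff_norm_le_one, mem_adicCompletionIntegers] at this
      exact this
    have hmul : Valued.v ((u.val : 𝒪[v.adicCompletion K]) : v.adicCompletion K) *
        Valued.v ((u.inv : 𝒪[v.adicCompletion K]) : v.adicCompletion K) = 1 := by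
      rw [← map_mul, ← Subring.coe_mul, u.val_inv, Subring.coe_one, map_one]
    have hval : Valued.v ((u.val : 𝒪[v.adicCompletion K]) : v.adicCompletion K) = 1 :=
      le_antisymm (hle _) (by
        by_contra hlt
        rw [not_le] at hlt
        have := mul_lt_one_of_lt_of_le hlt (hle u.inv)
        exact this.ne hmul)
    rw [hu] at hval
    exact hval
  rw [valuedAdicCompletion_eq_valuation'] at h1
  have hx0 : (x : K) ≠ 0 := fun h0 ↦ by
    rw [h0, map_zero] at h1
    exact zero_ne_one h1
  have hinv' : (x : K)⁻¹ ∈ (v.valuation K).valuationSubring := by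
    rw [Valuation.mem_valuationSubring_iff, map_inv₀, h1, inv_one]
  have hinv : (x : K)⁻¹ ∈ valuationSubringAtPrime K v :=
    (le_of_eq (valuationSubringAtPrime_eq_valuationSubring v).symm) hinv'
  exact ⟨⟨x, ⟨_, hinv⟩, Subtype.ext (mul_inv_cancel₀ hx0), Subtype.ext (inv_mul_cancel₀ hx0)⟩, rfl⟩

/-- `𝓞_{K,v} → R → κ(R)` is a local homomorphism into the field `κ(R)`. [folklore] -/
instance isLocalHom_residue_comp_toClosureValuationSubring :
    IsLocalHom ((IsLocalRing.residue (closureValuationSubring (v.adicCompletion K))).comp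
      (toClosureValuationSubring v)) := by
  haveI : IsLocalHom (toClosureValuationSubring v) := by
    unfold toClosureValuationSubring; infer_instance
  infer_instance

/-- The embedding `κ(v) → κ(R)` of residue fields induced by `𝓞_{K,v} → R`. [folklore] -/
def residueFieldToClosureResidueField :
    v.asIdeal.ResidueField →+* ResidueField (closureValuationSubring (v.adicCompletion K)) :=
  (IsLocalRing.ResidueField.lift ((IsLocalRing.residue _).comp (toClosureValuationSubring v))).comp
    (residueFieldEquiv v).symm.toRingHom

/-- Compatibility: `κ(v) → κ(R)` after `residueAt v` is `𝓞_{K,v} → R → κ(R)`. [folklore] -/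
theorem residueFieldToClosureResidueField_comp_residueAt :
    (residueFieldToClosureResidueField v).comp (residueAt v) =
      (IsLocalRing.residue _).comp (toClosureValuationSubring v) := by
  ext x
  change IsLocalRing.ResidueField.lift
      ((IsLocalRing.residue _).comp (toClosureValuationSubring v)) ((residueFieldEquiv v).symm
        (residueFieldEquiv v (IsLocalRing.residue _ x))) = _
  rw [RingEquiv.symm_apply_apply]
  rfl

/-- `κ(R)` as a `κ(v)`-algebra. [folklore] -/
instance closureResidueField.instAlgebra :
    Algebra v.asIdeal.ResidueField (ResidueField (closureValuationSubring (v.adicCompletion K))) :=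
  (residueFieldToClosureResidueField v).toAlgebra

/-- The finite residue field `𝓀_{K_v}` as a `κ(v)`-algebra (through `𝓞_{K,v} → 𝒪_{K_v}`).
[folklore] -/
def residueFieldToLocalResidueField : v.asIdeal.ResidueField →+* 𝓀[v.adicCompletion K] :=
  (IsLocalRing.ResidueField.lift ((IsLocalRing.residue _).comp (toLocalInteger v))).comp
    (residueFieldEquiv v).symm.toRingHom

/-- `κ(v) → κ(R)` factors through `𝓀_{K_v}`. [folklore] -/
theorem algebraMap_comp_residueFieldToLocalResidueField :
    (algebraMap 𝓀[v.adicCompletion K] (ResidueField (closureValuationSubring (v.adicCompletion K)))).comp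
        (residueFieldToLocalResidueField v) = residueFieldToClosureResidueField v := by
  apply RingHom.ext
  intro c
  obtain ⟨x, rfl⟩ := residueAt_surjective v c
  have h2 := RingHom.congr_fun (residueFieldToClosureResidueField_comp_residueAt v) x
  rw [RingHom.comp_apply] at h2
  rw [RingHom.comp_apply, h2]
  change algebraMap 𝓀[v.adicCompletion K] _ (IsLocalRing.ResidueField.lift
    ((IsLocalRing.residue _).comp (toLocalInteger v))
    ((residueFieldEquiv v).symm
      (residueFieldEquiv v (IsLocalRing.residue _ x)))) = _
  rw [RingEquiv.symm_apply_apply]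
  rfl

/-- **`κ(R)` is algebraic over `κ(v)`** (it is algebraic over the finite field `𝓀_{K_v}`, which is
algebraic over `κ(v)`). [cite: SerreLocalFields1979, Ch. IV §4 Cor. 2 to Prop. 16] -/
instance closureResidueField.isAlgebraic :
    Algebra.IsAlgebraic v.asIdeal.ResidueField (ResidueField (closureValuationSubring (v.adicCompletion K))) := by
  letI : Algebra v.asIdeal.ResidueField 𝓀[v.adicCompletion K] :=
    (residueFieldToLocalResidueField v).toAlgebra
  haveI : IsScalarTower v.asIdeal.ResidueField 𝓀[v.adicCompletion K]
      (ResidueField (closureValuationSubring (v.adicCompletion K))) :=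
    IsScalarTower.of_algebraMap_eq' (algebraMap_comp_residueFieldToLocalResidueField v).symm
  haveI : Module.Finite v.asIdeal.ResidueField 𝓀[v.adicCompletion K] := Module.Finite.of_finite
  haveI : Algebra.IsAlgebraic v.asIdeal.ResidueField 𝓀[v.adicCompletion K] :=
    Algebra.IsAlgebraic.of_finite _ _
  exact Algebra.IsAlgebraic.trans v.asIdeal.ResidueField 𝓀[v.adicCompletion K] _

/-- Hence `κ(R)` is an algebraic closure of `κ(v)`. [cite: SerreLocalFields1979, Ch. IV §4 Cor. 2 to Prop. 16] -/
instance closureResidueField.isAlgClosure :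
    IsAlgClosure v.asIdeal.ResidueField (ResidueField (closureValuationSubring (v.adicCompletion K))) where
  isAlgClosed := inferInstance
  isAlgebraic := inferInstance

/-- A `κ(v)`-isomorphism `κ̄(v) ≃ κ(R)` between the abstract algebraic closure of `κ(v)` and the
residue field of `K̄_v` (uniqueness of algebraic closures). [folklore] -/
def geomResidueFieldEquiv :
    geomResidueField v ≃ₐ[v.asIdeal.ResidueField] ResidueField (closureValuationSubring (v.adicCompletion K)) :=
  IsAlgClosure.equiv v.asIdeal.ResidueField _ _

/-- The geometric closed point `Spec κ̄(v)` of `Spec 𝓞_{K,v}` is `Spec κ(R)` (over `𝓞_{K,v}`).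
[folklore] -/
def geomClosedPointIsoSpecResidueField :
    specRingHomOver (closureValuationSubring (v.adicCompletion K)) (toClosureValuationSubring v)
        (IsLocalRing.residue (closureValuationSubring (v.adicCompletion K))) ≅ geomClosedPoint v :=
  Over.isoMk (Scheme.Spec.mapIso (geomResidueFieldEquiv v).toRingEquiv.toCommRingCatIso.op) (by
    change Spec.map _ ≫ Spec.map _ = Spec.map _ ≫ Spec.map _
    rw [← Spec.map_comp, ← Spec.map_comp, ← CommRingCat.ofHom_comp]
    congr 1
    change CommRingCat.ofHom (((geomResidueFieldEquiv v).toRingEquiv.toRingHom).comp (toGeomResidueField v)) = _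
    congr 1
    rw [← residueFieldToClosureResidueField_comp_residueAt]
    ext x
    exact (geomResidueFieldEquiv v).commutes (residueAt v x))

/-- **`𝒜(κ(R)) ≃* 𝒜_v(κ̄(v))`**: the points of the special fibre over the two algebraic closures of
`κ(v)` agree (as groups, for a group scheme). [folklore] -/
def residueFieldPointsEquiv (𝒳 : SchemeOver (valuationSubringAtPrime K v)) [GrpObj 𝒳] :
    residueFieldPoints 𝒳 ≃* specialFibreGeomPoints v 𝒳 :=
  MulEquiv.mk' ((geomClosedPointIsoSpecResidueField v).homCongr (Iso.refl 𝒳)) fun P Q ↦ by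
    change (geomClosedPointIsoSpecResidueField v).inv ≫ (P * Q) ≫ (Iso.refl 𝒳).hom =
      ((geomClosedPointIsoSpecResidueField v).inv ≫ P ≫ (Iso.refl 𝒳).hom) *
        ((geomClosedPointIsoSpecResidueField v).inv ≫ Q ≫ (Iso.refl 𝒳).hom)
    rw [Iso.refl_hom, Category.comp_id, Category.comp_id, Category.comp_id]
    exact MonObj.comp_mul _ _ _

end ResidueField

/-! ## The reduction map on geometric points `B(K̄) → 𝒜_v(κ(R))` as a reduction datum -/

section GlobalReduction

open scoped AddSubgroup

attribute [local instance] absClosureAlgebra absClosure_isScalarTower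

/-- The additive group `𝒳(κ(R))` (written additively) is a `Γ_{K_v}`-module. [folklore] -/
instance additiveResidueFieldPoints.instDistribMulAction (𝒳 : SchemeOver (valuationSubringAtPrime K v))
    [GrpObj 𝒳] :
    DistribMulAction (absoluteGaloisGroup (v.adicCompletion K)) (Additive (residueFieldPoints 𝒳)) where
  smul σ y := Additive.ofMul (σ • Additive.toMul y)
  one_smul y := congrArg Additive.ofMul (one_smul _ (Additive.toMul y))
  mul_smul σ τ y := congrArg Additive.ofMul (mul_smul σ τ (Additive.toMul y))
  smul_zero σ := congrArg Additive.ofMul (smul_one σ)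
  smul_add σ x y := congrArg Additive.ofMul (smul_mul' σ (Additive.toMul x) (Additive.toMul y))

/-- Definition of the action on `Additive (𝒳(κ(R)))`. [folklore] -/
theorem additiveResidueFieldPoints.toMul_smul {𝒳 : SchemeOver (valuationSubringAtPrime K v)} [GrpObj 𝒳]
    (σ : absoluteGaloisGroup (v.adicCompletion K)) (y : Additive (residueFieldPoints 𝒳)) :
    Additive.toMul (σ • y) = σ • Additive.toMul y := rfl

/-- **Inertia acts trivially** on `Additive (𝒳(κ(R)))`. [cite: SerreTate1968GoodReduction, §1 Lemma 2] -/
theorem additiveResidueFieldPoints.smul_eq_self_of_mem_absInertia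
    {𝒳 : SchemeOver (valuationSubringAtPrime K v)} [GrpObj 𝒳]
    {σ : absoluteGaloisGroup (v.adicCompletion K)} (hσ : σ ∈ absInertia (v.adicCompletion K))
    (y : Additive (residueFieldPoints 𝒳)) : σ • y = y :=
  congrArg Additive.ofMul (residueFieldPoints.smul_eq_self_of_mem_absInertia hσ (Additive.toMul y))

variable {v}

/-- `B(K̄) → B(K̄_v)` along the chosen embedding `ι : K̄ → K̄_v` (extension of scalars of points;
a group homomorphism, injective). [folklore] -/
def toAdicCompletionPoints (B : AbelianVariety K) (v : HeightOneSpectrum (𝓞 K)) :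
    B.Points (AlgebraicClosure K) →* B.Points (AlgebraicClosure (v.adicCompletion K)) :=
  Literature.AlgebraicGeometry.Motives.AlgPoints.extendScalarsMonoidHom B.X (AlgebraicClosure K)
    (AlgebraicClosure (v.adicCompletion K))

/-- `B(K̄) → B(K̄_v)` is injective. [folklore] -/
theorem toAdicCompletionPoints_injective (B : AbelianVariety K) (v : HeightOneSpectrum (𝓞 K)) :
    Function.Injective (toAdicCompletionPoints B v) :=
  Literature.AlgebraicGeometry.Motives.AlgPoints.extendScalars_injective B.X _ _

/-- `B(K̄) → B(K̄_v)` is equivariant along `res : Γ_{K_v} → Γ_K` (`ι (res τ • x) = τ • ι x`).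
[folklore] -/
theorem toAdicCompletionPoints_smul (B : AbelianVariety K) (v : HeightOneSpectrum (𝓞 K))
    (τ : absoluteGaloisGroup (v.adicCompletion K)) (P : B.Points (AlgebraicClosure K)) :
    toAdicCompletionPoints B v (absGaloisRestrict K (v.adicCompletion K) τ • P) =
      τ • toAdicCompletionPoints B v P := by
  symm
  refine Literature.AlgebraicGeometry.Motives.AlgPoints.smul_extendScalars B.X
    (absoluteGaloisGroup.toAlgEquiv K (absGaloisRestrict K (v.adicCompletion K) τ))
    (AlgEquiv.restrictScalars K (absoluteGaloisGroup.toAlgEquiv (v.adicCompletion K) τ))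
    (fun x ↦ ?_) P
  change τ • absClosureEmbedding K (v.adicCompletion K) x =
    absClosureEmbedding K (v.adicCompletion K) (absGaloisRestrict K (v.adicCompletion K) τ • x)
  exact (absGaloisRestrict_apply_smul K (v.adicCompletion K) τ x).symm

variable {B : AbelianVariety K} {𝒜 : SchemeOver (valuationSubringAtPrime K v)} [GrpObj 𝒜]

/-- **The reduction map on geometric points** `red : B(K̄) → 𝒜_v(κ(R))` (additively written):
`B(K̄) → B(K̄_v) = 𝒜(K̄_v) = 𝒜(R) → 𝒜(κ(R))`. Serre–Tate §1. [cite: SerreTate1968GoodReduction, §1] -/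
def IsAbelianSchemeModel.geomReductionHom (h : IsAbelianSchemeModel B v 𝒜) :
    B.geomPoints →+ Additive (residueFieldPoints 𝒜) :=
  MonoidHom.toAdditive (h.reductionHom.comp (toAdicCompletionPoints B v))

/-- Unfolding the reduction map on geometric points. [folklore] -/
theorem IsAbelianSchemeModel.geomReductionHom_apply (h : IsAbelianSchemeModel B v 𝒜) (P : B.geomPoints) :
    h.geomReductionHom P = Additive.ofMul (h.reductionHom (toAdicCompletionPoints B v (Additive.toMul P))) :=
  rfl

/-- **`red` is `Γ_{K_v}`-equivariant along `res`**: `red (res τ • P) = τ • red P`.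
[cite: SerreTate1968GoodReduction, §1] -/
theorem IsAbelianSchemeModel.geomReductionHom_smul (h : IsAbelianSchemeModel B v 𝒜)
    (τ : absoluteGaloisGroup (v.adicCompletion K)) (P : B.geomPoints) :
    h.geomReductionHom (absGaloisRestrict K (v.adicCompletion K) τ • P) = τ • h.geomReductionHom P := by
  rw [h.geomReductionHom_apply, h.geomReductionHom_apply,
    Literature.AlgebraicGeometry.Motives.AbelianVariety.toMul_smul, toAdicCompletionPoints_smul,
    h.reductionHom_smul]
  rfl

/-- `𝒜(κ(R)) ≃ 𝒜_v(κ̄(v))` additively: the composite of `residueFieldPointsEquiv` and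
`specialFibrePointsEquiv`. [folklore] -/
def IsAbelianSchemeModel.additiveResidueFieldPointsEquiv (h : IsAbelianSchemeModel B v 𝒜) :
    Additive (residueFieldPoints 𝒜) ≃+ h.specialFibre.geomPoints :=
  MulEquiv.toAdditive ((residueFieldPointsEquiv v 𝒜).trans h.specialFibrePointsEquiv)

/-- **The action of `Γ_{K_v}` on the geometric points `𝒜_v(κ̄(v))` of the special fibre abelian
variety**, transported from its action on `𝒜(κ(R))` (through `Γ_{K_v} → Aut(κ(R)/κ(v))`) along
`𝒜(κ(R)) ≃ 𝒜_v(κ̄(v))`.  A `def` (it depends on the model datum `h`), used through `letI`.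
[cite: SerreTate1968GoodReduction, §1] -/
@[reducible] def IsAbelianSchemeModel.specialFibreGeomPointsAction (h : IsAbelianSchemeModel B v 𝒜) :
    DistribMulAction (absoluteGaloisGroup (v.adicCompletion K)) h.specialFibre.geomPoints where
  smul σ Q := h.additiveResidueFieldPointsEquiv (σ • h.additiveResidueFieldPointsEquiv.symm Q)
  one_smul Q := by
    change h.additiveResidueFieldPointsEquiv ((1 : absoluteGaloisGroup (v.adicCompletion K)) • _) = Q
    rw [one_smul, AddEquiv.apply_symm_apply]
  mul_smul σ τ Q := by
    change h.additiveResidueFieldPointsEquiv ((σ * τ) • _) =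
      h.additiveResidueFieldPointsEquiv (σ • h.additiveResidueFieldPointsEquiv.symm
        (h.additiveResidueFieldPointsEquiv (τ • _)))
    rw [mul_smul, AddEquiv.symm_apply_apply]
  smul_zero σ := by
    change h.additiveResidueFieldPointsEquiv (σ • h.additiveResidueFieldPointsEquiv.symm 0) = 0
    rw [map_zero, smul_zero, map_zero]
  smul_add σ P Q := by
    change h.additiveResidueFieldPointsEquiv (σ • h.additiveResidueFieldPointsEquiv.symm (P + Q)) =
      h.additiveResidueFieldPointsEquiv (σ • _) + h.additiveResidueFieldPointsEquiv (σ • _)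
    rw [map_add, smul_add, map_add]

/-- Definition of the transported action. [folklore] -/
theorem IsAbelianSchemeModel.specialFibreGeomPoints_smul_def (h : IsAbelianSchemeModel B v 𝒜)
    (σ : absoluteGaloisGroup (v.adicCompletion K)) (Q : h.specialFibre.geomPoints) :
    letI := h.specialFibreGeomPointsAction
    σ • Q = h.additiveResidueFieldPointsEquiv (σ • h.additiveResidueFieldPointsEquiv.symm Q) :=
  rfl

/-- **Inertia acts trivially on `𝒜_v(κ̄(v))`.** [cite: SerreTate1968GoodReduction, §1 Lemma 2] -/
theorem IsAbelianSchemeModel.specialFibreGeomPoints_smul_eq_self_of_mem_absInertia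
    (h : IsAbelianSchemeModel B v 𝒜) {σ : absoluteGaloisGroup (v.adicCompletion K)}
    (hσ : σ ∈ absInertia (v.adicCompletion K)) (Q : h.specialFibre.geomPoints) :
    letI := h.specialFibreGeomPointsAction
    σ • Q = Q := by
  letI := h.specialFibreGeomPointsAction
  rw [h.specialFibreGeomPoints_smul_def, additiveResidueFieldPoints.smul_eq_self_of_mem_absInertia v hσ,
    AddEquiv.apply_symm_apply]

/-- **The reduction map `red_v : B(K̄) → 𝒜_v(κ̄(v))`** into the geometric points of the special
fibre abelian variety: `geomReductionHom` followed by `𝒜(κ(R)) ≃ 𝒜_v(κ̄(v))`.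
Serre–Tate §1. [cite: SerreTate1968GoodReduction, §1] -/
def IsAbelianSchemeModel.specialFibreReductionHom (h : IsAbelianSchemeModel B v 𝒜) :
    B.geomPoints →+ h.specialFibre.geomPoints :=
  h.additiveResidueFieldPointsEquiv.toAddMonoidHom.comp h.geomReductionHom

/-- Unfolding `specialFibreReductionHom`. [folklore] -/
theorem IsAbelianSchemeModel.specialFibreReductionHom_apply (h : IsAbelianSchemeModel B v 𝒜)
    (P : B.geomPoints) :
    h.specialFibreReductionHom P = h.additiveResidueFieldPointsEquiv (h.geomReductionHom P) :=
  rfl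

/-- **`red_v` is `Γ_{K_v}`-equivariant along `res`.** [cite: SerreTate1968GoodReduction, §1] -/
theorem IsAbelianSchemeModel.specialFibreReductionHom_smul (h : IsAbelianSchemeModel B v 𝒜)
    (τ : absoluteGaloisGroup (v.adicCompletion K)) (P : B.geomPoints) :
    letI := h.specialFibreGeomPointsAction
    h.specialFibreReductionHom (absGaloisRestrict K (v.adicCompletion K) τ • P) =
      τ • h.specialFibreReductionHom P := by
  letI := h.specialFibreGeomPointsAction
  rw [h.specialFibreReductionHom_apply, h.specialFibreReductionHom_apply, h.geomReductionHom_smul,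
    h.specialFibreGeomPoints_smul_def, AddEquiv.symm_apply_apply]

/-- **The ordinary filtration from the reduction map of a model, modulo surjectivity on torsion
and isotropy.**  For an abelian-scheme model `𝒜` of `B` at `v ∣ p` with ordinary special fibre,
the reduction datum `red_v = specialFibreReductionHom` of this file is `Γ_{K_v}`-equivariant with
inertia acting trivially, and `#𝒜_v[pⁿ](κ̄(v)) = p^{(dim B) n}`
(`natCard_geomTorsion_specialFibre_pow`); so, granted that `red_v` is onto on `pⁿ`-torsion, a
Weil-type pairing `e` on `V_p B` and the isotropy of `ker V_p(red_v)`, the subspace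
`W = ker V_p(red_v)` satisfies the four clauses of `ordinaryReduction_tateModule_filtration`
(assembly `exists_ordinaryFiltration_of_reduction`). [cite: Greenberg1991, §2 (p. 214)] -/
theorem IsAbelianSchemeModel.exists_ordinaryFiltration (h : IsAbelianSchemeModel B v 𝒜)
    (p : ℕ) [Fact p.Prime] (hpv : ((p : ℕ) : 𝓞 K) ∈ v.asIdeal)
    (hord : specialFibrePTorsionCard v 𝒜 = residueChar v ^ B.dim)
    (hsurj : ∀ n, ∀ y ∈ h.specialFibre.geomTorsion (p ^ n : ℕ),
      ∃ x ∈ B.geomTorsion (p ^ n : ℕ), h.specialFibreReductionHom x = y)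
    (e : LinearMap.BilinForm ℚ_[p] (B.rationalTateModule p)) (he : e.Nondegenerate)
    (heq : ∀ (g : absoluteGaloisGroup K) (x y : B.rationalTateModule p),
      e (B.rationalTateRep p g x) (B.rationalTateRep p g y) =
        (((GaloisRep.cyclotomicCharacter K p g : ℤ_[p]ˣ) : ℤ_[p]) : ℚ_[p]) * e x y)
    (hiso : ∀ x y : B.rationalTateModule p,
      (TateModule.map p h.specialFibreReductionHom).baseChange ℚ_[p] x = 0 →
        (TateModule.map p h.specialFibreReductionHom).baseChange ℚ_[p] y = 0 → e x y = 0) :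
    ∃ W : Submodule ℚ_[p] (B.rationalTateModule p),
      Module.finrank ℚ_[p] W = B.dim ∧
      (∀ (τ : absoluteGaloisGroup (v.adicCompletion K)), ∀ w ∈ W,
          B.rationalTateRep p (absGaloisRestrict K (v.adicCompletion K) τ) w ∈ W) ∧
      (∀ τ ∈ absInertia (v.adicCompletion K), ∀ w ∈ W,
          B.rationalTateRep p (absGaloisRestrict K (v.adicCompletion K) τ) w =
            (((GaloisRep.cyclotomicCharacter (v.adicCompletion K) p τ : ℤ_[p]ˣ) : ℤ_[p]) :
              ℚ_[p]) • w) ∧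
      (∀ τ ∈ absInertia (v.adicCompletion K), ∀ x : B.rationalTateModule p,
          B.rationalTateRep p (absGaloisRestrict K (v.adicCompletion K) τ) x - x ∈ W) := by
  letI := h.specialFibreGeomPointsAction
  exact exists_ordinaryFiltration_of_reduction B v p h.specialFibreReductionHom
    h.specialFibreReductionHom_smul
    (fun _ hτ y ↦ h.specialFibreGeomPoints_smul_eq_self_of_mem_absInertia hτ y)
    (h.natCard_geomTorsion_specialFibre_pow hpv hord) hsurj e he heq hiso

end GlobalReduction

/-! ## Torsion: `B(K̄)[n] = B(K̄_v)[n]`, and the reduction of `hsurj` to lifting torsion points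
of the model -/

section Torsion

attribute [local instance] absClosureAlgebra absClosure_isScalarTower

variable {v}

/-- **`B(K̄)[n] → B(K̄_v)[n]` is onto** (both have `n^{2 dim B}` elements, Mumford §6 Appl. 3, and
the map is injective). [cite: MumfordAV1970, §6 Application 3 (Proposition p. 64)] -/
theorem exists_torsionPoints_toAdicCompletionPoints_eq (B : AbelianVariety K) (v : HeightOneSpectrum (𝓞 K))
    (n : ℤ) (hn : n ≠ 0) (Q : B.Points (AlgebraicClosure (v.adicCompletion K)))
    (hQ : Q ∈ B.torsionPoints (AlgebraicClosure (v.adicCompletion K)) n) :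
    ∃ P ∈ B.torsionPoints (AlgebraicClosure K) n, toAdicCompletionPoints B v P = Q := by
  have hnK : (n : K) ≠ 0 := Int.cast_ne_zero.mpr hn
  let f : B.torsionPoints (AlgebraicClosure K) n →
      B.torsionPoints (AlgebraicClosure (v.adicCompletion K)) n :=
    fun P ↦ ⟨toAdicCompletionPoints B v P, by
      rw [AbelianVariety.mem_torsionPoints_iff, ← map_zpow,
        (AbelianVariety.mem_torsionPoints_iff n (P : B.Points (AlgebraicClosure K))).mp P.2, map_one]⟩
  have hf : Function.Injective f := fun P P' hPP' ↦
    Subtype.ext (toAdicCompletionPoints_injective B v (congrArg Subtype.val hPP'))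
  have hcardK := B.natCard_torsionPoints_eq_of_isAlgClosed (AlgebraicClosure K) n hnK
  have hcardΩ := B.natCard_torsionPoints_eq_of_isAlgClosed (AlgebraicClosure (v.adicCompletion K)) n hnK
  haveI : Finite (B.torsionPoints (AlgebraicClosure (v.adicCompletion K)) n) :=
    Nat.finite_of_card_ne_zero (by rw [hcardΩ]; exact pow_ne_zero _ (Int.natAbs_ne_zero.mpr hn))
  have hbij : Function.Bijective f := hf.bijective_of_nat_card_le (by rw [hcardK, hcardΩ])
  obtain ⟨P, hP⟩ := hbij.2 ⟨Q, hQ⟩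
  exact ⟨P, P.2, congrArg Subtype.val hP⟩

variable {B : AbelianVariety K} {𝒜 : SchemeOver (valuationSubringAtPrime K v)} [GrpObj 𝒜]

/-- **Reduction of `hsurj` to the model.**  If every `m`-torsion point of `𝒜(κ(R))` is the
reduction of an `m`-torsion `Ω`-point of `𝒜` (a statement about the proper group scheme `𝒜` over
`𝓞_{K,v}` and the valuation ring `R` of `K̄_v` alone), then the reduction map
`red_v : B(K̄) → 𝒜_v(κ̄(v))` is onto on `m`-torsion — the hypothesis `hsurj` of
`IsAbelianSchemeModel.exists_ordinaryFiltration`. [cite: SerreTate1968GoodReduction, §1 Lemma 2] -/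
theorem IsAbelianSchemeModel.specialFibreReductionHom_torsion_surjective_of_lift
    (h : IsAbelianSchemeModel B v 𝒜) {m : ℕ} (hm : m ≠ 0)
    (H : ∀ y : residueFieldPoints 𝒜, y ^ m = 1 →
      ∃ P : specFractionField (closureValuationSubring (v.adicCompletion K)) (toClosureValuationSubring v) ⟶ 𝒜,
        P ^ m = 1 ∧ (haveI := h.isProper;
          reducePointMonoidHom (closureValuationSubring (v.adicCompletion K)) (toClosureValuationSubring v) 𝒜
            (IsLocalRing.residue _) P) = y) :
    ∀ y ∈ h.specialFibre.geomTorsion (m : ℕ), ∃ x ∈ B.geomTorsion (m : ℕ),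
      h.specialFibreReductionHom x = y := by
  haveI := h.isProper
  intro y hy
  set y' := h.additiveResidueFieldPointsEquiv.symm y with hy'def
  have hy' : (Additive.toMul y') ^ m = 1 := by
    have h1 : (m : ℤ) • y' = 0 := by
      rw [hy'def, ← map_zsmul, (AbelianVariety.mem_geomTorsion_iff' y).mp hy, map_zero]
    have h2 : (Additive.toMul y') ^ (m : ℤ) = 1 := congrArg Additive.toMul h1
    rwa [zpow_natCast] at h2
  obtain ⟨P, hPm, hPred⟩ := H (Additive.toMul y') hy'
  set Q := h.fractionFieldPointsEquiv P with hQdef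
  have hQ : Q ∈ B.torsionPoints (AlgebraicClosure (v.adicCompletion K)) (m : ℤ) := by
    rw [AbelianVariety.mem_torsionPoints_iff, zpow_natCast, hQdef, ← map_pow, hPm, map_one]
  obtain ⟨P₀, hP₀, hι⟩ := exists_torsionPoints_toAdicCompletionPoints_eq B v (m : ℤ)
    (Int.natCast_ne_zero.mpr hm) Q hQ
  refine ⟨Additive.ofMul P₀, (AbelianVariety.mem_geomTorsion_iff _).mpr hP₀, ?_⟩
  rw [h.specialFibreReductionHom_apply, h.geomReductionHom_apply]
  change h.additiveResidueFieldPointsEquiv (Additive.ofMul (h.reductionHom (toAdicCompletionPoints B v P₀))) = y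
  rw [hι, h.reductionHom_apply, hQdef, MulEquiv.symm_apply_apply, hPred]
  exact h.additiveResidueFieldPointsEquiv.apply_symm_apply y

end Torsion

end Literature.NumberTheory.DiophantineGeometry
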